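import Literature.AlgebraicGeometry.Resolution.DerivationCompletion
import Mathlib.RingTheory.Localization.AtPrime.Basic
import Mathlib.RingTheory.Spectrum.Prime.Topology
import HarnessLib

/-!
# Giraud's critical locus `E(f)` is closed where the absolute differentials are free

Route `ResolutionOfSingularities/RadicialJung`, crux `CleanModels` (stmt-ResolutionOfSingularities-15917),
line `via-clean-models` of crux `DescentPerfectToAll` (stmt-ResolutionOfSingularities-0549): brick
K3b-ii of PROGRAMME-clean-dim2. Helper file (`--supports`), OURS; nothing here is a statement of
Hironaka's manuscript.

Giraud (Bull. SMF 111 (1983), Déf. 1.2) attaches to a function `f` on a regular scheme `X` of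
characteristic `p` the closed set `E(f)` of points where `df ∈ 𝔪_x Ω¹_X` — for him `Ω¹_X` is locally
free OF FINITE RANK (`X` `F`-finite). Over an arbitrary ground field the tree reads `E(f)` without
`Ω¹` (`forall_derivation_apply_mem_iff_exists_sub_pow_mem_sq`, p545307): `x ∈ E(f)` iff every
derivation of `𝒪_{X,x}` maps `f` into `𝔪_x` iff `f ∈ 𝒪_{X,x}^p + 𝔪_x²`. This file proves the
CLOSEDNESS of `E(f)` in the derivation reading on any affine piece `Spec B` whose module of absolute
differentials `Ω[B⁄ℤ]` is FREE (of any rank): there `E(f)` is the zero locus of the coordinates of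
`df` in a basis. Such pieces cover every regular scheme of finite type over any field of
characteristic `p` (`exists_free_kaehler_localization_away`, file
`RadicialJungCleanModelsAbsoluteDifferentialsStructure.lean`, with
`formallySmooth_zmod_of_isRegularLocalRing_of_essFiniteType`).

* `setOf_forall_derivation_mem_eq_zeroLocus` — for `B` with `Ω[B⁄ℤ]` free on a basis `b` and
  `f ∈ B`: `{𝔮 : every derivation of B_𝔮 maps f into 𝔮B_𝔮} = V({b.repr (df) i : i})`;
* `isClosed_setOf_forall_derivation_mem` — hence this set is closed in `Spec B`.

Proof. If all coordinates of `df` lie in `𝔮`, a derivation `D` of `B_𝔮` restricted to `B` factors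
through `Ω[B⁄ℤ]` and `D f = Σ cᵢ · (…) ∈ 𝔮 B_𝔮`. If a coordinate `cᵢ ∉ 𝔮`, the coordinate derivation
`δ = b.coord i ∘ d` has `δ f = cᵢ` and extends to `B_𝔮` (Stacks 07PE, the tree's
`exists_derivation_extend_of_isLocalizedModule`), where `cᵢ` is a unit.

## References
* J. Giraud, *Forme normale d'une fonction sur une surface de caractéristique positive*, Bull. Soc.
  Math. France 111 (1983), Déf. 1.2 and 2.2 (3) ("`Sing(X, ω)` est un fermé"). [Giraud1983]
* The Stacks Project, Tag 07PE. [StacksProject]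
-/

noncomputable section

set_option linter.dupNamespace false -- mandated namespace of this single-conjunct summit

open KaehlerDifferential Module IsLocalRing
open Literature.AlgebraicGeometry.Resolution

-- as in `DerivationCompletion.lean`: one `ℤ`-algebra / `ℤ`-module structure throughout
attribute [local instance 1100] Ring.toIntAlgebra AddCommGroup.toIntModule

namespace Summit.ResolutionOfSingularities.ResolutionOfSingularities.Theorems.RadicialJung.CleanModels

universe u v

/-- **`E(f) = V(coordinates of df)`** on `Spec B` when `Ω[B⁄ℤ]` is free with basis `b`: a prime
`𝔮` has the property «every derivation `D` of `B_𝔮` sends `f` into the maximal ideal» iff all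
coordinates `b.repr (df) i` lie in `𝔮`. [cite: Giraud1983, Déf. 1.2, 2.2 (3)]
[cite: StacksProject, Tag 07PE] -/
theorem setOf_forall_derivation_mem_eq_zeroLocus {B : Type u} [CommRing B] {ι : Type v}
    (b : Basis ι B Ω[B⁄ℤ]) (f : B) :
    {Q : PrimeSpectrum B |
        ∀ D : Derivation ℤ (Localization.AtPrime Q.asIdeal) (Localization.AtPrime Q.asIdeal),
          D (algebraMap B (Localization.AtPrime Q.asIdeal) f) ∈
            maximalIdeal (Localization.AtPrime Q.asIdeal)} =
      PrimeSpectrum.zeroLocus (Set.range fun i => b.repr (D ℤ B f) i) := by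
  classical
  ext Q
  simp only [Set.mem_setOf_eq, PrimeSpectrum.mem_zeroLocus, Set.range_subset_iff,
    SetLike.mem_coe]
  set L := Localization.AtPrime Q.asIdeal
  constructor
  · -- a coordinate outside `𝔮` gives a derivation of `B_𝔮` with unit value on `f`
    intro h i
    by_contra hi
    -- the coordinate derivation `δ = b.coord i ∘ d` (`δ f = cᵢ`), extended to `B_𝔮` (Stacks 07PE)
    let δ : Derivation ℤ B B := (b.coord i).compDer (D ℤ B)
    have hδ : δ f = b.repr (D ℤ B f) i := rfl
    obtain ⟨δ', hδ'⟩ := exists_derivation_extend_of_isLocalizedModule Q.asIdeal.primeCompl L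
      (Algebra.linearMap B L) δ
    have hmem := h δ'
    rw [hδ', Algebra.linearMap_apply, hδ,
      IsLocalization.AtPrime.to_map_mem_maximal_iff L Q.asIdeal] at hmem
    exact hi hmem
  · -- all coordinates in `𝔮`: every derivation of `B_𝔮` kills `f` modulo `𝔮`
    intro h D'
    let δ : Derivation ℤ B L := D'.compAlgebraMap B
    have hδf : D' (algebraMap B L f) = δ.liftKaehlerDifferential (D ℤ B f) := by
      rw [Derivation.liftKaehlerDifferential_comp_D]
      rfl
    rw [hδf, ← b.linearCombination_repr (D ℤ B f), Finsupp.apply_linearCombination,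
      Finsupp.linearCombination_apply]
    refine Submodule.sum_mem _ fun i _ => ?_
    simp only [Function.comp_apply, Algebra.smul_def]
    exact Ideal.mul_mem_right _ _
      ((IsLocalization.AtPrime.to_map_mem_maximal_iff L Q.asIdeal _).mpr (h i))

/-- **Giraud's `E(f)` is closed** on `Spec B` when `Ω[B⁄ℤ]` is free: the set of primes `𝔮` at which
every derivation of `B_𝔮` maps `f` into the maximal ideal is closed (it is a zero locus,
`setOf_forall_derivation_mem_eq_zeroLocus`). [cite: Giraud1983, 2.2 (3)] -/
theorem isClosed_setOf_forall_derivation_mem {B : Type u} [CommRing B]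
    [Module.Free B Ω[B⁄ℤ]] (f : B) :
    IsClosed {Q : PrimeSpectrum B |
        ∀ D : Derivation ℤ (Localization.AtPrime Q.asIdeal) (Localization.AtPrime Q.asIdeal),
          D (algebraMap B (Localization.AtPrime Q.asIdeal) f) ∈
            maximalIdeal (Localization.AtPrime Q.asIdeal)} := by
  rw [setOf_forall_derivation_mem_eq_zeroLocus (Module.Free.chooseBasis B Ω[B⁄ℤ]) f]
  exact PrimeSpectrum.isClosed_zeroLocus _

end Summit.ResolutionOfSingularities.ResolutionOfSingularities.Theorems.RadicialJung.CleanModels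

end
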